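import Summits.BirchSwinnertonDyer.BirchSwinnertonDyer.Theorems.SignedBalanceX9CoprimeFrameSupply
import Summits.BirchSwinnertonDyer.BirchSwinnertonDyer.Theorems.SignedBalanceX9AssemblyViaUpperCoprime
import HarnessLib

/-!
# Route `SignedBalanceX9`: the one-sided coprime separation with the twisted crux DISCHARGED modulo print —
# `FourTermDefectUpperCoprimeX9 → AnalyticMuZeroX9 → BRR2022_thm_1 → PublishedInputsX9 → IntegralMainConjectureOnClassX9`

Lead prover seat `bsd-line-sbx9-p1` (line coprime-frame of crux `TwistedAnalyticMuZeroCoprimeX9`, item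
stmt-BirchSwinnertonDyer-25216), cell `pub/bsd-print-x9`. THEOREMS ONLY (no definition, no named fact, no `sorry`).

The route's glue `AssemblyViaUpperCoprime := FourTermDefectUpperCoprimeX9 → AnalyticMuZeroX9 →
TwistedAnalyticMuZeroCoprimeX9 → PublishedInputsX9 → IntegralMainConjectureOnClassX9` is PROVED in the tree
(`SignedBalanceCoprime.signedBalanceX9_assemblyViaUpperCoprime`, p601079), and the twisted crux is now the kernel theorem
`SignedBalanceX9CoprimeFrame.twistedAnalyticMuZeroCoprimeX9_of_publishedInputs : BRR2022_thm_1 → AnalyticMuZeroX9 →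
PublishedInputsX9 → TwistedAnalyticMuZeroCoprimeX9` (p607311: Dirichlet/CRT for `d_F`; Beckwith–Raum–Richter 2022 Thm. 1 +
Hurwitz class numbers + Cox 7.24 for the coprime `d_K ≡ 1 (mod 8)`; twist stability of class X9 + Néron models + modularity
for the three unit coefficients). Composing the two:

* `assemblyViaUpperCoprime_of_print` — **`FourTermDefectUpperCoprimeX9 → AnalyticMuZeroX9 →
  Literature.NumberTheory.QuadraticFields.BRR2022_thm_1 → PublishedInputsX9 → IntegralMainConjectureOnClassX9`**: the K6
  rank-`0` engine of class X9 from the one-sided four-term defect inequality at coprime frames (item 25217, PRINT ∧ MEMO,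
  formalisation XL), Greenberg's analytic `μ = 0` on X9 (item 19630, OPEN), ONE print fact (BRR 2022 Thm. 1, cite-only)
  and the published inputs (item 19632) — i.e. the route's cone WITHOUT the twisted crux 25216.
* `bsdpOnClassX9_of_print_inputs` — the same composed with the route's deciding bridge: `… → SchneiderX9RankOne →
  BSDpOnClassX9` (the K6 leaf), displaying the route's residual open content BY NAME as
  {`FourTermDefectUpperCoprimeX9`, `AnalyticMuZeroX9`, `SchneiderX9RankOne`} + print {`BRR2022_thm_1`, `PublishedInputsX9`}.

CONDITIONAL (every antecedent is a hypothesis); nothing is booked; no summit, leaf or crux is proved; BSD is not proved.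
References: [BurungaleCastellaSkinner2025] Thm. 1.1.2 (a), §1.2, Lemma 5.2.3; [BeckwithRaumRichter2022] Thm. 1;
[GreenbergLNM1716] Conj. 1.11, Thm. 4.1; [Schneider1985]; [PerrinRiou1987].
-/

set_option linter.dupNamespace false
set_option autoImplicit false

noncomputable section

open Summit.BirchSwinnertonDyer.BirchSwinnertonDyer.Theses.SignedBalanceX9
  (FourTermDefectUpperCoprimeX9 AnalyticMuZeroX9 TwistedAnalyticMuZeroCoprimeX9 PublishedInputsX9 SchneiderX9RankOne
    AssemblyViaUpperCoprime closes)
open Summit.BirchSwinnertonDyer.BirchSwinnertonDyer.Theorems.SignedBalanceX9CoprimeFrame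
  (twistedAnalyticMuZeroCoprimeX9_of_publishedInputs)

namespace Summit.BirchSwinnertonDyer.BirchSwinnertonDyer.Rank1Residual.SignedBalanceCoprime

/-- **The coprime one-sided separation with the twisted crux discharged modulo print**:
`FourTermDefectUpperCoprimeX9 → AnalyticMuZeroX9 → BRR2022_thm_1 → PublishedInputsX9 → IntegralMainConjectureOnClassX9`.
Proof: `signedBalanceX9_assemblyViaUpperCoprime` fed with the kernel theorem
`twistedAnalyticMuZeroCoprimeX9_of_publishedInputs hBRR hMu hPub` in place of the crux `TwistedAnalyticMuZeroCoprimeX9`.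
TURNKEY shape for an `…OfPrint` re-typing of the route's glue item 25218 with 25216 dropped from the cone.
[cite: BurungaleCastellaSkinner2025, Thm. 1.1.2 (a) and Lemma 5.2.3] [cite: BeckwithRaumRichter2022, Theorem 1]
[cite: GreenbergLNM1716, §1 Conj. 1.11] -/
theorem assemblyViaUpperCoprime_of_print (hUp : FourTermDefectUpperCoprimeX9) (hMu : AnalyticMuZeroX9)
    (hBRR : Literature.NumberTheory.QuadraticFields.BRR2022_thm_1) (hPub : PublishedInputsX9) :
    Summit.BirchSwinnertonDyer.BirchSwinnertonDyer.Rank1Residual.IntegralMainConjectureOnClassX9 :=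
  signedBalanceX9_assemblyViaUpperCoprime hUp hMu (twistedAnalyticMuZeroCoprimeX9_of_publishedInputs hBRR hMu hPub) hPub

/-- **The K6 leaf `BSDpOnClassX9` from the route's residual cone BY NAME** — `FourTermDefectUpperCoprimeX9` (25217) ∧
`AnalyticMuZeroX9` (19630) ∧ `BRR2022_thm_1` (print) ∧ `PublishedInputsX9` (19632, print) ∧ `SchneiderX9RankOne` (19631):
the route's deciding `closes` with its binder `hTwC` supplied by `twistedAnalyticMuZeroCoprimeX9_of_publishedInputs` and
`hAsmC` by the landed `assemblyViaUpperCoprime_holds`. CONDITIONAL; nothing booked; BSD is not proved.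
[cite: BurungaleCastellaSkinner2025, Thm. 1.1.2 (a)] [cite: GreenbergLNM1716, §1 Conj. 1.11 and Thm. 4.1]
[cite: BeckwithRaumRichter2022, Theorem 1] -/
theorem bsdpOnClassX9_of_print_inputs (hUp : FourTermDefectUpperCoprimeX9) (hMu : AnalyticMuZeroX9)
    (hBRR : Literature.NumberTheory.QuadraticFields.BRR2022_thm_1) (hPub : PublishedInputsX9)
    (hSch : SchneiderX9RankOne) :
    Summit.BirchSwinnertonDyer.BirchSwinnertonDyer.Rank1Residual.BSDpOnClassX9 := by
  -- (buildfix 2026-08-28) the route's `closes` was re-keyed (10:36Z) to the `…OfPrint` items (MastellaZerman /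
  -- PassagePrintFacts binders); this accepted statement keeps `FourTermDefectUpperCoprimeX9` itself, so the pre-edit
  -- chain of `closes` is inlined: the coprime assembly gives the integral main conjecture on the class, then the
  -- print inputs + Schneider give `BSDpOnClassX9`.
  have hIMC := assemblyViaUpperCoprime_holds hUp hMu (twistedAnalyticMuZeroCoprimeX9_of_publishedInputs hBRR hMu hPub) hPub
  obtain ⟨-, hGr, h5, hS, hPR, hmodP, hmodL, hGZK⟩ := hPub
  exact Summit.BirchSwinnertonDyer.BirchSwinnertonDyer.Rank1Residual.bsdpOnClassX9_of_integralMainConjectureOnClassX9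
    hGr h5 hS hPR hmodP hmodL hGZK hIMC hSch

end Summit.BirchSwinnertonDyer.BirchSwinnertonDyer.Rank1Residual.SignedBalanceCoprime

end
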